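import Summits.KontsevichZagierPeriods.KontsevichZagierPeriods.Theses.SymplecticScissors
import Summits.KontsevichZagierPeriods.KontsevichZagierPeriods.Theses.HardSphereVirial
import Summits.KontsevichZagierPeriods.KontsevichZagierPeriods.Theses.SphericalSchlafli
import Summits.KontsevichZagierPeriods.KontsevichZagierPeriods.Theses.ScissorsTransport
import Summits.KontsevichZagierPeriods.KontsevichZagierPeriods.Theses.BoundaryLevel
import Summits.KontsevichZagierPeriods.KontsevichZagierPeriods.Theses.WeightFloor
import Literature.NumberTheory.Transcendental.KZVolumeConjectureProofs
import Literature.NumberTheory.Transcendental.KZKernelConjectureForms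

/-!
# KontsevichZagierPeriods — the shared assembly `VolumeForm → KontsevichZagierPeriods` (stmt-KontsevichZagierPeriods-3822)

Item stmt-KontsevichZagierPeriods-3822 (`Assembly`, rank 1) is shared verbatim by the volume-form
routes SymplecticScissors, HardSphereVirial, SphericalSchlafli, BoundaryLevel, WeightFloor
(`….Theses.<Route>.Assembly`) and ScissorsTransport (`….Theses.ScissorsTransport.Assembly2`, no
longer declared by its route file since the 2026-08-16 multi-assembly autofix, hence re-declared
verbatim below):

  `VolumeForm → KontsevichZagierPeriods`,

where `VolumeForm` says that, in every dimension `N`, two integrand-`1` representations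
`r r' : KZ.IntegralRep N` (two `ℚ`-semialgebraic sets of finite volume) with the same value are
KZ-equivalent, and the summit `KontsevichZagierPeriods = Literature.Periods.KZPeriodConjecture` is
Conjecture 1 of [Kontsevich–Zagier 2001, §1.2] for representations of KZ's literal (rational) shape.

Proof ("difference of volumes + slabs + gluing + soundness"), entirely from landed tree theorems:

* `VolumeForm` drops the hypotheses "compact" and "non-empty interior" of the printed volume
  conjecture `KZ.volumeConjectureCompact` [Cresson–Viu-Sos 2022, §1 p. 326], so it implies it by
  specialisation;
* `KZ.kzPeriodConjecture'_iff_volumeConjectureCompact_holds`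
  (`Literature/NumberTheory/Transcendental/KZVolumeConjectureProofs.lean`, proved there together with the discharge
  `KZ.semiCanonicalReduction_holds` of [Viu-Sos 2021, Thm. 1.1]: sign split, region under the
  graph by one Newton–Leibniz move, grounding + monomial compression to bounded volumes, cube
  counting; then unit slabs to a common dimension, gluing of disjoint slabs by domain additivity,
  and soundness of the moves to compare the two glued volumes) turns the volume conjecture into the
  two-representation form `KZPeriodConjecture'`;
* `kzPeriodConjecture'_iff_isRational` (`KZKernelConjectureForms.lean`) restricts it to
  rational-shape endpoints, which is verbatim the body of the summit statement.

No hypothesis beyond `VolumeForm` is used; the six route decls are definitionally one statement and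
are all settled here: the primary one (this prover's route) is `symplecticScissors_assembly_proof`,
the other five are the same term.

References: M. Kontsevich, D. Zagier, *Periods* (2001), §§1.1–1.2; J. Viu-Sos, IJNT 17 (2021),
Thm. 1.1; J. Cresson, J. Viu-Sos, JTNB 34 (2022), §1 pp. 325–326.
-/

namespace Summit.KontsevichZagierPeriods.KontsevichZagierPeriods.Theses.ScissorsTransport

-- `Summit.<Summit>.<Problem>` is the tree's mandated summit-side namespace (CONVENTIONS §2); for this
-- single-conjunct summit the two coincide, so the duplicate is deliberate.
set_option linter.dupNamespace false in
/-- The assembly variant `Assembly2` of route ScissorsTransport (the shared item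
stmt-KontsevichZagierPeriods-3822): `VolumeForm → KontsevichZagierPeriods`, the item's signature
verbatim over this route's own `VolumeForm`. The route file stopped declaring it on 2026-08-16
(multi-assembly autofix: duplicate assembly variants dropped, the proved record of the item kept), so
it is re-declared here solely so that its proved record `scissorsTransport_assembly2_proof` below
keeps elaborating unchanged (a definition, not a cited fact). -/
def Assembly2 : Prop :=
  VolumeForm → KontsevichZagierPeriods

end Summit.KontsevichZagierPeriods.KontsevichZagierPeriods.Theses.ScissorsTransport

namespace Summit.KontsevichZagierPeriods.VolumeFormAssembly

open Literature.NumberTheory.Transcendental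

/-- **Assembly of route SymplecticScissors** (settles stmt-KontsevichZagierPeriods-3822):
`VolumeForm → KontsevichZagierPeriods`. If, in every dimension `N`, any two integrand-`1`
representations of equal value are KZ-equivalent, then any two representations of KZ's literal
shape with equal value are KZ-equivalent. The hypothesis specialises to the printed volume
conjecture `KZ.volumeConjectureCompact` (forget "compact" and "non-empty interior"), which is
equivalent to the two-representation form `KZPeriodConjecture'` by
`KZ.kzPeriodConjecture'_iff_volumeConjectureCompact_holds` [Cresson–Viu-Sos 2022, §1 p. 326, with
Viu-Sos 2021 Thm. 1.1 discharged in tree: difference of volumes, slabs, gluing, soundness], and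
`KZPeriodConjecture'` restricts to rational-shape endpoints — verbatim the summit body — by
`kzPeriodConjecture'_iff_isRational`. [Kontsevich–Zagier 2001, §1.2, Conjecture 1] [folklore] -/
theorem symplecticScissors_assembly_proof :
    Summit.KontsevichZagierPeriods.KontsevichZagierPeriods.Theses.SymplecticScissors.Assembly := by
  unfold KontsevichZagierPeriods.Theses.SymplecticScissors.Assembly
  intro hV
  have hvc : KZ.volumeConjectureCompact := by
    intro _ r r' _ _ _ _ h1 h1' hv
    exact hV r r' h1 h1' hv
  exact kzPeriodConjecture'_iff_isRational.mp
    (KZ.kzPeriodConjecture'_iff_volumeConjectureCompact_holds.mpr hvc)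

/-- **Assembly of route HardSphereVirial** (the same shared item stmt-KontsevichZagierPeriods-3822,
verbatim the same statement `VolumeForm → KontsevichZagierPeriods`, definitionally equal to the
SymplecticScissors decl): the same term. [Kontsevich–Zagier 2001, §1.2; Cresson–Viu-Sos 2022, §1
p. 326] [folklore] -/
theorem hardSphereVirial_assembly_proof :
    Summit.KontsevichZagierPeriods.KontsevichZagierPeriods.Theses.HardSphereVirial.Assembly :=
  symplecticScissors_assembly_proof

/-- **Assembly of route SphericalSchlafli** (the same shared item stmt-KontsevichZagierPeriods-3822,
verbatim the same statement `VolumeForm → KontsevichZagierPeriods`, definitionally equal to the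
SymplecticScissors decl): the same term. [Kontsevich–Zagier 2001, §1.2; Cresson–Viu-Sos 2022, §1
p. 326] [folklore] -/
theorem sphericalSchlafli_assembly_proof :
    Summit.KontsevichZagierPeriods.KontsevichZagierPeriods.Theses.SphericalSchlafli.Assembly :=
  symplecticScissors_assembly_proof

/-- **Assembly of route ScissorsTransport** (`Assembly2`; the same shared item
stmt-KontsevichZagierPeriods-3822, verbatim the same statement `VolumeForm → KontsevichZagierPeriods`,
definitionally equal to the SymplecticScissors decl): the same term. [Kontsevich–Zagier 2001, §1.2;
Cresson–Viu-Sos 2022, §1 p. 326] [folklore] -/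
theorem scissorsTransport_assembly2_proof :
    Summit.KontsevichZagierPeriods.KontsevichZagierPeriods.Theses.ScissorsTransport.Assembly2 :=
  symplecticScissors_assembly_proof

/-- **Assembly of route BoundaryLevel** (the same shared item stmt-KontsevichZagierPeriods-3822,
verbatim the same statement `VolumeForm → KontsevichZagierPeriods`, definitionally equal to the
SymplecticScissors decl): the same term. [Kontsevich–Zagier 2001, §1.2; Cresson–Viu-Sos 2022, §1
p. 326] [folklore] -/
theorem boundaryLevel_assembly_proof :
    Summit.KontsevichZagierPeriods.KontsevichZagierPeriods.Theses.BoundaryLevel.Assembly :=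
  symplecticScissors_assembly_proof

/-- **Assembly of route WeightFloor** (the same shared item stmt-KontsevichZagierPeriods-3822,
verbatim the same statement `VolumeForm → KontsevichZagierPeriods`, definitionally equal to the
SymplecticScissors decl): the same term. [Kontsevich–Zagier 2001, §1.2; Cresson–Viu-Sos 2022, §1
p. 326] [folklore] -/
theorem weightFloor_assembly_proof :
    Summit.KontsevichZagierPeriods.KontsevichZagierPeriods.Theses.WeightFloor.Assembly :=
  symplecticScissors_assembly_proof

end Summit.KontsevichZagierPeriods.VolumeFormAssembly
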